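import Literature.Analysis.UnboundedOperators.HeatFlowCalculus
import Literature.Analysis.UnboundedOperators.HeatKernelGradient
import HarnessLib

/-!
# The caloric extension of bounded data: derivatives on the data, Hölder gains, sup bounds

Analysis/UnboundedOperators support file (all results proved; no named facts). It serves the
discharge of the BDSV time-regularity step `Literature.Analysis.FluidPDE.BDSV.timeRegularity`
(`FluidPDE/OnsagerBDSV`; Buckmaster–De Lellis–Székelyhidi–Vicol 2019, §2.2), whose proof
mollifies a spatially Hölder velocity field; here the mollifier is the Gauss–Weierstrass kernel
`G_t = heatKernel t` and the mollification is the accepted caloric extension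
`e^{tΔ} g = heatExtension g t` (`HeatKernel.lean`), applied to *bounded* (e.g. periodic) data
rather than to `L^p` or compactly supported data.

Let `E` be a finite-dimensional real inner product space, `n = finrank ℝ E`, `F` a real Banach
space, `0 < t`.

## Main results

* Kernel moments: `∫ ∇G_t = 0` (`integral_fderiv_heatKernel_eq_zero`),
  `∫ G_t(y) ‖y‖ dy ≤ 2·2^{n/2} t^{1/2}` (`integral_heatKernel_mul_norm_le`),
  `∫ G_t(y) ‖y‖^β dy ≤ (1 + 2·2^{n/2}) t^{β/2}` for `0 ≤ β ≤ 1`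
  (`integral_heatKernel_mul_norm_rpow_le`), the pointwise Gaussian bound
  `‖∇G_t(y)‖ ≤ 2^{n/2} t^{-1/2} G_{2t}(y)` (`norm_fderiv_heatKernel_le_heatKernel_two_mul`) and
  `∫ ‖∇G_t(y)‖ ‖y‖^β dy ≤ 2^{n/2} t^{-1/2} (1 + 2·2^{n/2}) (2t)^{β/2}`.
* Derivatives fall on bounded `C¹` data: `D(e^{tΔ} g) = e^{tΔ}(Dg)` for `g ∈ C¹` with `g`, `Dg`
  bounded (`fderiv_heatExtension_apply_of_bounded`, from `HeatFlowCalculus`), and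
  `Δ(e^{tΔ} g) = e^{tΔ}(Δg)` for `g ∈ C²` with bounded derivatives up to order two
  (`laplacian_heatExtension_of_bounded`); hence the heat equation with the Laplacian on the data
  (`hasDerivAt_heatExtension_time_of_bounded`).
* Sup bounds: `‖∇(e^{tΔ} f)(x)‖ ≤ 2^{n/2} t^{-1/2} sup ‖f‖` for bounded measurable `f`
  (`norm_fderiv_heatExtension_le_of_bounded`; Giga–Giga–Saal, §1.1.3, case `p = ∞`).
* Hölder gains: if `‖g y - g z‖ ≤ A ‖y - z‖^β` (`0 ≤ β ≤ 1`) and `g` is bounded and continuous,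
  then `‖e^{tΔ} g (x) - g x‖ ≤ (1 + 2·2^{n/2}) A t^{β/2}` (`norm_heatExtension_sub_self_le_of_holder`)
  and `‖∇(e^{tΔ} g)(x)‖ ≤ 2^{n/2} (1 + 2·2^{n/2}) 2^{β/2} A t^{(β-1)/2}`
  (`norm_fderiv_heatExtension_le_of_holder`): the standard mollification estimates
  `‖f ⋆ ψ_ℓ - f‖₀ ≲ [f]_β ℓ^β`, `‖∇(f ⋆ ψ_ℓ)‖₀ ≲ [f]_β ℓ^{β-1}` (BDSV 2019, §2.2, with `ℓ = √t`).

## References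

* T. Buckmaster, C. De Lellis, L. Székelyhidi Jr., V. Vicol, *Onsager's conjecture for admissible
  weak solutions*, CPAM 72 (2019), §2.2 ("standard mollification estimates").
* M.-H. Giga, Y. Giga, J. Saal, *Nonlinear Partial Differential Equations* (2010), §1.1.3
  (derivative estimates for `e^{tΔ}`).
* L. C. Evans, *Partial Differential Equations*, 2nd ed. (2010), §2.3.1, Thm. 1.
-/

noncomputable section

open MeasureTheory Set Filter Topology InnerProductSpace
open scoped Real ENNReal NNReal Convolution Laplacian

namespace Literature.Analysis.UnboundedOperators

/-! ### An elementary splitting inequality -/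

/-- For `0 ≤ a`, `0 < r`, `0 ≤ β ≤ 1`: `a^β ≤ r^β + r^{β-1} a` (split at `a = r`). [folklore] -/
theorem rpow_le_rpow_add_rpow_sub_one_mul {a r β : ℝ} (ha : 0 ≤ a) (hr : 0 < r) (hβ0 : 0 ≤ β)
    (hβ1 : β ≤ 1) : a ^ β ≤ r ^ β + r ^ (β - 1) * a := by
  have h1 : 0 ≤ r ^ β := Real.rpow_nonneg hr.le β
  have h2 : 0 ≤ r ^ (β - 1) * a := mul_nonneg (Real.rpow_nonneg hr.le _) ha
  rcases le_or_gt a r with har | har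
  · exact (Real.rpow_le_rpow ha har hβ0).trans (le_add_of_nonneg_right h2)
  · have ha0 : 0 < a := hr.trans har
    have h3 : a ^ β = a ^ (β - 1) * a := by
      rw [Real.rpow_sub_one ha0.ne', div_mul_cancel₀ _ ha0.ne']
    have h4 : a ^ (β - 1) ≤ r ^ (β - 1) :=
      Real.rpow_le_rpow_of_nonpos hr har.le (by linarith)
    rw [h3]
    exact le_add_of_nonneg_of_le h1 (mul_le_mul_of_nonneg_right h4 ha)

/-! ### Moments of the heat kernel and of its gradient -/

section Kernel

variable {E : Type*} [NormedAddCommGroup E] [InnerProductSpace ℝ E] [FiniteDimensional ℝ E]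
  [MeasurableSpace E] [BorelSpace E]

/-- The norm of the gradient of the heat kernel is integrable (`0 < t`; from
`lintegral_enorm_fderiv_heatKernel_le`; cf. `BMOInv.integrable_fderiv_heatKernel` in
`FunctionSpaces/BMOCarlesonFeffermanStein`, not imported here). [folklore] -/
theorem integrable_norm_fderiv_heatKernel {t : ℝ} (ht : 0 < t) :
    Integrable (fun y => ‖fderiv ℝ (heatKernel (E := E) t) y‖) := by
  refine ⟨(continuous_fderiv_heatKernel t).norm.aestronglyMeasurable, ?_⟩
  rw [hasFiniteIntegral_norm_iff]
  exact (lintegral_enorm_fderiv_heatKernel_le ht).trans_lt ENNReal.ofReal_lt_top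

/-- `∫ ∇G_t(y) dy = 0` (oddness of the gradient, invariance of Lebesgue measure under `y ↦ -y`).
[folklore] -/
theorem integral_fderiv_heatKernel_eq_zero (t : ℝ) :
    ∫ y, fderiv ℝ (heatKernel (E := E) t) y = 0 := by
  have hodd : ∀ y : E, fderiv ℝ (heatKernel t) (-y) = -fderiv ℝ (heatKernel t) y := fun y => by
    ext v
    rw [fderiv_heatKernel_neg_apply, FunLike.coe_neg, Pi.neg_apply]
  have h := integral_neg_eq_self (fun y => fderiv ℝ (heatKernel (E := E) t) y) volume
  simp_rw [hodd, integral_neg] at h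
  -- `h : -I = I`
  have h2 : (2 : ℝ) • ∫ y, fderiv ℝ (heatKernel (E := E) t) y = 0 := by
    rw [two_smul]
    nth_rewrite 1 [← h]
    exact neg_add_cancel _
  exact (smul_eq_zero.1 h2).resolve_left two_ne_zero

/-- `‖G_t(y)‖ ‖y‖`-integrability: `y ↦ G_t(y) ‖y‖ = 2t ‖∇G_t(y)‖` is integrable (`0 < t`).
[folklore] -/
theorem integrable_heatKernel_mul_norm {t : ℝ} (ht : 0 < t) :
    Integrable (fun y : E => heatKernel t y * ‖y‖) := by
  have h : (fun y : E => heatKernel t y * ‖y‖) = fun y => (2 * t) * ‖fderiv ℝ (heatKernel t) y‖ := by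
    funext y
    rw [norm_fderiv_heatKernel ht]
    field_simp
  rw [h]
  exact (integrable_norm_fderiv_heatKernel ht).const_mul _

/-- `∫ ‖∇G_t‖ ≤ 2^{n/2} t^{-1/2}` (real-valued form of `lintegral_enorm_fderiv_heatKernel_le`).
[cite: GigaGigaSaal2010, §1.1.3] -/
theorem integral_norm_fderiv_heatKernel_le {t : ℝ} (ht : 0 < t) :
    ∫ y, ‖fderiv ℝ (heatKernel (E := E) t) y‖ ≤
      (2 : ℝ) ^ ((Module.finrank ℝ E : ℝ) / 2) * t ^ (-(1 / 2 : ℝ)) := by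
  have hnn : 0 ≤ (2 : ℝ) ^ ((Module.finrank ℝ E : ℝ) / 2) * t ^ (-(1 / 2 : ℝ)) := by positivity
  rw [integral_norm_eq_lintegral_enorm (continuous_fderiv_heatKernel t).aestronglyMeasurable]
  exact ENNReal.toReal_le_of_le_ofReal hnn (lintegral_enorm_fderiv_heatKernel_le ht)

/-- First absolute moment: `∫ G_t(y) ‖y‖ dy ≤ 2 · 2^{n/2} t^{1/2}` (`G_t(y)‖y‖ = 2t‖∇G_t(y)‖`).
[folklore] -/
theorem integral_heatKernel_mul_norm_le {t : ℝ} (ht : 0 < t) :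
    ∫ y : E, heatKernel t y * ‖y‖ ≤
      2 * (2 : ℝ) ^ ((Module.finrank ℝ E : ℝ) / 2) * t ^ (1 / 2 : ℝ) := by
  have h : (fun y : E => heatKernel t y * ‖y‖) = fun y => (2 * t) * ‖fderiv ℝ (heatKernel t) y‖ := by
    funext y
    rw [norm_fderiv_heatKernel ht]
    field_simp
  rw [h, integral_const_mul]
  calc 2 * t * ∫ y, ‖fderiv ℝ (heatKernel (E := E) t) y‖
      ≤ 2 * t * ((2 : ℝ) ^ ((Module.finrank ℝ E : ℝ) / 2) * t ^ (-(1 / 2 : ℝ))) :=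
        mul_le_mul_of_nonneg_left (integral_norm_fderiv_heatKernel_le ht) (by positivity)
    _ = 2 * (2 : ℝ) ^ ((Module.finrank ℝ E : ℝ) / 2) * (t * t ^ (-(1 / 2 : ℝ))) := by ring
    _ = 2 * (2 : ℝ) ^ ((Module.finrank ℝ E : ℝ) / 2) * t ^ (1 / 2 : ℝ) := by
        congr 1
        rw [show t * t ^ (-(1 / 2 : ℝ)) = t ^ (1 : ℝ) * t ^ (-(1 / 2 : ℝ)) by rw [Real.rpow_one],
          ← Real.rpow_add ht]
        norm_num

/-- `β`-moment of the heat kernel, `0 ≤ β ≤ 1`: `∫ G_t(y) ‖y‖^β dy ≤ (1 + 2·2^{n/2}) t^{β/2}`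
(split `‖y‖^β ≤ r^β + r^{β-1}‖y‖` at `r = √t`, mass one and the first moment). [folklore] -/
theorem integral_heatKernel_mul_norm_rpow_le {t : ℝ} (ht : 0 < t) {β : ℝ} (hβ0 : 0 ≤ β)
    (hβ1 : β ≤ 1) :
    ∫ y : E, heatKernel t y * ‖y‖ ^ β ≤
      (1 + 2 * (2 : ℝ) ^ ((Module.finrank ℝ E : ℝ) / 2)) * t ^ (β / 2) := by
  set r : ℝ := t ^ (1 / 2 : ℝ) with hr
  have hr0 : 0 < r := Real.rpow_pos_of_pos ht _
  have hK := integrable_heatKernel_holds (E := E) ht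
  have hpt : ∀ y : E, heatKernel t y * ‖y‖ ^ β ≤
      heatKernel t y * r ^ β + r ^ (β - 1) * (heatKernel t y * ‖y‖) := fun y => by
    have h := rpow_le_rpow_add_rpow_sub_one_mul (norm_nonneg y) hr0 hβ0 hβ1
    have hG := (heatKernel_pos ht y).le
    calc heatKernel t y * ‖y‖ ^ β ≤ heatKernel t y * (r ^ β + r ^ (β - 1) * ‖y‖) :=
          mul_le_mul_of_nonneg_left h hG
      _ = _ := by ring
  have hdom : Integrable (fun y : E => heatKernel t y * r ^ β + r ^ (β - 1) * (heatKernel t y * ‖y‖)) :=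
    (hK.mul_const _).add ((integrable_heatKernel_mul_norm ht).const_mul _)
  have hmeas : AEStronglyMeasurable (fun y : E => heatKernel t y * ‖y‖ ^ β) volume :=
    ((continuous_heatKernel t).mul (continuous_norm.rpow_const fun _ => Or.inr hβ0)).aestronglyMeasurable
  have hint : Integrable (fun y : E => heatKernel t y * ‖y‖ ^ β) :=
    hdom.mono' hmeas (Eventually.of_forall fun y => by
      rw [Real.norm_of_nonneg (mul_nonneg (heatKernel_pos ht y).le (Real.rpow_nonneg (norm_nonneg _) _))]
      exact hpt y)
  calc ∫ y : E, heatKernel t y * ‖y‖ ^ β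
      ≤ ∫ y : E, (heatKernel t y * r ^ β + r ^ (β - 1) * (heatKernel t y * ‖y‖)) :=
        integral_mono hint hdom hpt
    _ = r ^ β + r ^ (β - 1) * ∫ y : E, heatKernel t y * ‖y‖ := by
        rw [integral_add (hK.mul_const _) ((integrable_heatKernel_mul_norm ht).const_mul _),
          integral_mul_const, integral_const_mul, integral_heatKernel_eq_one_holds ht, one_mul]
    _ ≤ r ^ β + r ^ (β - 1) * (2 * (2 : ℝ) ^ ((Module.finrank ℝ E : ℝ) / 2) * t ^ (1 / 2 : ℝ)) :=
        add_le_add le_rfl (mul_le_mul_of_nonneg_left (integral_heatKernel_mul_norm_le ht)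
          (Real.rpow_nonneg hr0.le _))
    _ = (1 + 2 * (2 : ℝ) ^ ((Module.finrank ℝ E : ℝ) / 2)) * t ^ (β / 2) := by
        have h1 : r ^ β = t ^ (β / 2) := by
          rw [hr, ← Real.rpow_mul ht.le]; congr 1; ring
        have h2 : r ^ (β - 1) * t ^ (1 / 2 : ℝ) = t ^ (β / 2) := by
          rw [hr, ← Real.rpow_mul ht.le, ← Real.rpow_add ht]; congr 1; ring
        rw [h1, show r ^ (β - 1) * (2 * (2 : ℝ) ^ ((Module.finrank ℝ E : ℝ) / 2) * t ^ (1 / 2 : ℝ)) =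
          2 * (2 : ℝ) ^ ((Module.finrank ℝ E : ℝ) / 2) * (r ^ (β - 1) * t ^ (1 / 2 : ℝ)) by ring, h2]
        ring

omit [FiniteDimensional ℝ E] [MeasurableSpace E] [BorelSpace E] in
/-- Gaussian bound on the gradient in terms of the kernel at double time:
`‖∇G_t(y)‖ ≤ 2^{n/2} t^{-1/2} G_{2t}(y)` (from `norm_fderiv_heatKernel_le`). [folklore] -/
theorem norm_fderiv_heatKernel_le_heatKernel_two_mul {t : ℝ} (ht : 0 < t) (y : E) :
    ‖fderiv ℝ (heatKernel t) y‖ ≤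
      (2 : ℝ) ^ ((Module.finrank ℝ E : ℝ) / 2) * t ^ (-(1 / 2 : ℝ)) * heatKernel (2 * t) y := by
  set n : ℝ := (Module.finrank ℝ E : ℝ) with hn
  refine (norm_fderiv_heatKernel_le ht y).trans_eq ?_
  rw [heatKernel_eq (2 * t) y]
  have h8 : -(1 / (4 * (2 * t))) * ‖y‖ ^ 2 = -(1 / (8 * t)) * ‖y‖ ^ 2 := by ring_nf
  rw [h8]
  have hsqrt : (Real.sqrt t)⁻¹ = t ^ (-(1 / 2 : ℝ)) := by
    rw [Real.sqrt_eq_rpow, ← Real.rpow_neg ht.le]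
  have hsplit : (4 * π * t) ^ (-n / 2) = (2 : ℝ) ^ (n / 2) * (4 * π * (2 * t)) ^ (-n / 2) := by
    rw [show 4 * π * (2 * t) = 2 * (4 * π * t) by ring,
      Real.mul_rpow (by norm_num : (0 : ℝ) ≤ 2) (by positivity), ← mul_assoc,
      show -n / 2 = -(n / 2) by ring, Real.rpow_neg (by norm_num : (0 : ℝ) ≤ 2),
      mul_inv_cancel₀ (Real.rpow_pos_of_pos two_pos _).ne', one_mul]
  rw [hsqrt, hsplit]
  ring

/-- `∫ ‖∇G_t(y)‖ ‖y‖^β dy ≤ 2^{n/2} t^{-1/2} (1 + 2·2^{n/2}) (2t)^{β/2}` for `0 ≤ β ≤ 1`.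
[folklore] -/
theorem integral_norm_fderiv_heatKernel_mul_norm_rpow_le {t : ℝ} (ht : 0 < t) {β : ℝ}
    (hβ0 : 0 ≤ β) (hβ1 : β ≤ 1) :
    ∫ y : E, ‖fderiv ℝ (heatKernel t) y‖ * ‖y‖ ^ β ≤
      (2 : ℝ) ^ ((Module.finrank ℝ E : ℝ) / 2) * t ^ (-(1 / 2 : ℝ)) *
        ((1 + 2 * (2 : ℝ) ^ ((Module.finrank ℝ E : ℝ) / 2)) * (2 * t) ^ (β / 2)) := by
  set c : ℝ := (2 : ℝ) ^ ((Module.finrank ℝ E : ℝ) / 2) * t ^ (-(1 / 2 : ℝ)) with hc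
  have hc0 : 0 ≤ c := by positivity
  have h2t : 0 < 2 * t := by positivity
  have hK2 := integrable_heatKernel_holds (E := E) h2t
  -- integrability of the right-hand side weight
  have hr0 : 0 < (2 * t) ^ (1 / 2 : ℝ) := Real.rpow_pos_of_pos h2t _
  have hdom : Integrable (fun y : E => c * (heatKernel (2 * t) y * ((2 * t) ^ (1 / 2 : ℝ)) ^ β +
      ((2 * t) ^ (1 / 2 : ℝ)) ^ (β - 1) * (heatKernel (2 * t) y * ‖y‖))) :=
    ((hK2.mul_const _).add ((integrable_heatKernel_mul_norm h2t).const_mul _)).const_mul c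
  have hpt : ∀ y : E, ‖fderiv ℝ (heatKernel t) y‖ * ‖y‖ ^ β ≤
      c * (heatKernel (2 * t) y * ((2 * t) ^ (1 / 2 : ℝ)) ^ β +
        ((2 * t) ^ (1 / 2 : ℝ)) ^ (β - 1) * (heatKernel (2 * t) y * ‖y‖)) := fun y => by
    have hG := (heatKernel_pos h2t y).le
    have h1 : ‖fderiv ℝ (heatKernel t) y‖ * ‖y‖ ^ β ≤ (c * heatKernel (2 * t) y) * ‖y‖ ^ β :=
      mul_le_mul_of_nonneg_right (norm_fderiv_heatKernel_le_heatKernel_two_mul ht y)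
        (Real.rpow_nonneg (norm_nonneg _) _)
    have h2 := rpow_le_rpow_add_rpow_sub_one_mul (norm_nonneg y) hr0 hβ0 hβ1
    calc ‖fderiv ℝ (heatKernel t) y‖ * ‖y‖ ^ β ≤ (c * heatKernel (2 * t) y) * ‖y‖ ^ β := h1
      _ ≤ (c * heatKernel (2 * t) y) * (((2 * t) ^ (1 / 2 : ℝ)) ^ β +
            ((2 * t) ^ (1 / 2 : ℝ)) ^ (β - 1) * ‖y‖) :=
          mul_le_mul_of_nonneg_left h2 (mul_nonneg hc0 hG)
      _ = _ := by ring
  have hmeas : AEStronglyMeasurable (fun y : E => ‖fderiv ℝ (heatKernel t) y‖ * ‖y‖ ^ β) volume :=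
    ((continuous_fderiv_heatKernel t).norm.mul
      (continuous_norm.rpow_const fun _ => Or.inr hβ0)).aestronglyMeasurable
  have hint : Integrable (fun y : E => ‖fderiv ℝ (heatKernel t) y‖ * ‖y‖ ^ β) :=
    hdom.mono' hmeas (Eventually.of_forall fun y => by
      rw [Real.norm_of_nonneg (mul_nonneg (norm_nonneg _) (Real.rpow_nonneg (norm_nonneg _) _))]
      exact hpt y)
  calc ∫ y : E, ‖fderiv ℝ (heatKernel t) y‖ * ‖y‖ ^ β
      ≤ ∫ y : E, c * (heatKernel (2 * t) y * ((2 * t) ^ (1 / 2 : ℝ)) ^ β +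
          ((2 * t) ^ (1 / 2 : ℝ)) ^ (β - 1) * (heatKernel (2 * t) y * ‖y‖)) :=
        integral_mono hint hdom hpt
    _ = c * (((2 * t) ^ (1 / 2 : ℝ)) ^ β +
          ((2 * t) ^ (1 / 2 : ℝ)) ^ (β - 1) * ∫ y : E, heatKernel (2 * t) y * ‖y‖) := by
        rw [integral_const_mul, integral_add (hK2.mul_const _)
          ((integrable_heatKernel_mul_norm h2t).const_mul _), integral_mul_const,
          integral_const_mul, integral_heatKernel_eq_one_holds h2t, one_mul]
    _ ≤ c * (((2 * t) ^ (1 / 2 : ℝ)) ^ β + ((2 * t) ^ (1 / 2 : ℝ)) ^ (β - 1) *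
          (2 * (2 : ℝ) ^ ((Module.finrank ℝ E : ℝ) / 2) * (2 * t) ^ (1 / 2 : ℝ))) := by
        exact mul_le_mul_of_nonneg_left (add_le_add le_rfl (mul_le_mul_of_nonneg_left
          (integral_heatKernel_mul_norm_le h2t) (Real.rpow_nonneg hr0.le _))) hc0
    _ = c * ((1 + 2 * (2 : ℝ) ^ ((Module.finrank ℝ E : ℝ) / 2)) * (2 * t) ^ (β / 2)) := by
        have h1 : ((2 * t) ^ (1 / 2 : ℝ)) ^ β = (2 * t) ^ (β / 2) := by
          rw [← Real.rpow_mul h2t.le]; congr 1; ring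
        have h2 : ((2 * t) ^ (1 / 2 : ℝ)) ^ (β - 1) * (2 * t) ^ (1 / 2 : ℝ) = (2 * t) ^ (β / 2) := by
          rw [← Real.rpow_mul h2t.le, ← Real.rpow_add h2t]; congr 1; ring
        rw [h1, show ((2 * t) ^ (1 / 2 : ℝ)) ^ (β - 1) *
            (2 * (2 : ℝ) ^ ((Module.finrank ℝ E : ℝ) / 2) * (2 * t) ^ (1 / 2 : ℝ)) =
          2 * (2 : ℝ) ^ ((Module.finrank ℝ E : ℝ) / 2) *
            (((2 * t) ^ (1 / 2 : ℝ)) ^ (β - 1) * (2 * t) ^ (1 / 2 : ℝ)) by ring, h2]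
        ring

end Kernel

/-! ### The caloric extension of bounded data -/

section BoundedData

variable {E : Type*} [NormedAddCommGroup E] [InnerProductSpace ℝ E] [FiniteDimensional ℝ E]
  [MeasurableSpace E] [BorelSpace E]
variable {F : Type*} [NormedAddCommGroup F] [NormedSpace ℝ F]

omit [NormedSpace ℝ F] in
/-- Bounded continuous functions are in `L^∞`. [folklore] -/
theorem memLp_top_of_continuous_of_bound {g : E → F} (hg : Continuous g) {C : ℝ}
    (hC : ∀ z, ‖g z‖ ≤ C) : MemLp g ∞ (volume : Measure E) :=
  memLp_top_of_bound hg.aestronglyMeasurable C (Eventually.of_forall hC)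

/-- `y ↦ G_t(y) • g (x - y)` is integrable for bounded continuous `g` and `0 < t`. [folklore] -/
theorem integrable_heatKernel_smul_of_bound {g : E → F} (hg : Continuous g) {C : ℝ}
    (hC : ∀ z, ‖g z‖ ≤ C) {t : ℝ} (ht : 0 < t) (x : E) :
    Integrable (fun y => heatKernel t y • g (x - y)) := by
  refine ((integrable_heatKernel_holds ht).mul_const C).mono'
    ((continuous_heatKernel t).smul (hg.comp (continuous_const.sub continuous_id))).aestronglyMeasurable
    (Eventually.of_forall fun y => ?_)
  rw [norm_smul, Real.norm_of_nonneg (heatKernel_pos ht y).le]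
  exact mul_le_mul_of_nonneg_left (hC _) (heatKernel_pos ht y).le

/-- **Derivatives fall on bounded `C¹` data** (directional form): if `g ∈ C¹` is continuous
and bounded with `∂ᵥ g` bounded, then `∂ᵥ(e^{tΔ} g)(x) = e^{tΔ}(∂ᵥ g)(x)` for `0 < t` — the case
`p = q = ∞` of the tree's `fderiv_heatExtension_apply_eq_heatExtension_fderiv`
(`HeatFlowCalculus`). Lemarié-Rieusset 2016, §6.2. [folklore] -/
theorem fderiv_heatExtension_apply_of_bounded [CompleteSpace F] {g : E → F} (hg : ContDiff ℝ 1 g)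
    {C₀ C₁ : ℝ} (h0 : ∀ z, ‖g z‖ ≤ C₀) {v : E} (h1 : ∀ z, ‖fderiv ℝ g z v‖ ≤ C₁) {t : ℝ}
    (ht : 0 < t) (x : E) :
    fderiv ℝ (heatExtension g t) x v = heatExtension (fun z => fderiv ℝ g z v) t x :=
  fderiv_heatExtension_apply_eq_heatExtension_fderiv hg
    (memLp_top_of_continuous_of_bound hg.continuous h0) le_top
    (memLp_top_of_continuous_of_bound ((hg.continuous_fderiv one_ne_zero).clm_apply
      continuous_const) h1) le_top ht x

/-- The caloric extension of bounded continuous data is smooth in space (`0 < t`). [folklore] -/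
theorem contDiff_heatExtension_of_bound [CompleteSpace F] {g : E → F} (hg : Continuous g) {C : ℝ}
    (hC : ∀ z, ‖g z‖ ≤ C) {t : ℝ} (ht : 0 < t) {m : ℕ∞} :
    ContDiff ℝ m (heatExtension g t) :=
  (contDiff_heatExtension_holds (memLp_top_of_continuous_of_bound hg hC) le_top ht).of_le
    (by exact_mod_cast le_top)

/-- **The Laplacian falls on bounded `C²` data**: if `g ∈ C²` with `g`, `Dg`, `D²g` bounded,
then `Δ(e^{tΔ} g)(x) = e^{tΔ}(Δg)(x)` for `0 < t`. Lemarié-Rieusset 2016, §6.2. [folklore] -/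
theorem laplacian_heatExtension_of_bounded [CompleteSpace F] {g : E → F} (hg : ContDiff ℝ 2 g)
    {C₀ C₁ C₂ : ℝ} (h0 : ∀ z, ‖g z‖ ≤ C₀) (h1 : ∀ z, ‖fderiv ℝ g z‖ ≤ C₁)
    (h2 : ∀ z, ‖fderiv ℝ (fderiv ℝ g) z‖ ≤ C₂) {t : ℝ} (ht : 0 < t) (x : E) :
    (Δ (heatExtension g t)) x = heatExtension (Δ g) t x := by
  set b := stdOrthonormalBasis ℝ E with hb
  have hg1 : ContDiff ℝ 1 g := hg.of_le one_le_two
  -- the partial derivatives of `g`, their bounds and their derivatives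
  have hgi : ∀ i, ContDiff ℝ 1 fun z => fderiv ℝ g z (b i) := fun i =>
    (hg.fderiv_right (m := 1) le_rfl).clm_apply contDiff_const
  have hgi0 : ∀ i z, ‖fderiv ℝ g z (b i)‖ ≤ C₁ := fun i z => by
    refine (ContinuousLinearMap.le_opNorm _ _).trans ?_
    rw [b.orthonormal.1 i, mul_one]
    exact h1 z
  have hgi1 : ∀ i z, ‖fderiv ℝ (fun z' => fderiv ℝ g z' (b i)) z‖ ≤ C₂ := fun i z => by
    have hd : DifferentiableAt ℝ (fderiv ℝ g) z :=
      ((hg.fderiv_right (m := 1) le_rfl).differentiable one_ne_zero) z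
    rw [fderiv_clm_apply hd (differentiableAt_const _)]
    simp only [fderiv_fun_const, Pi.zero_apply, ContinuousLinearMap.comp_zero, zero_add]
    refine ContinuousLinearMap.opNorm_le_bound _
      ((norm_nonneg (fderiv ℝ (fderiv ℝ g) z)).trans (h2 z)) fun w => ?_
    rw [ContinuousLinearMap.flip_apply]
    calc ‖fderiv ℝ (fderiv ℝ g) z w (b i)‖ ≤ ‖fderiv ℝ (fderiv ℝ g) z w‖ * ‖b i‖ :=
          ContinuousLinearMap.le_opNorm _ _
      _ ≤ ‖fderiv ℝ (fderiv ℝ g) z‖ * ‖w‖ * ‖b i‖ :=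
          mul_le_mul_of_nonneg_right (ContinuousLinearMap.le_opNorm _ _) (norm_nonneg _)
      _ ≤ C₂ * ‖w‖ := by rw [b.orthonormal.1 i, mul_one]; gcongr; exact h2 z
  -- pure second derivatives as `fderiv ∘ fderiv` for `C²` maps
  have hpure : ∀ {v : E → F}, ContDiff ℝ 2 v → ∀ y e,
      iteratedFDeriv ℝ 2 v y ![e, e] = fderiv ℝ (fun z => fderiv ℝ v z e) y e := by
    intro v hv y e
    have hd : DifferentiableAt ℝ (fderiv ℝ v) y :=
      ((hv.fderiv_right (m := 1) le_rfl).differentiable one_ne_zero) y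
    rw [iteratedFDeriv_two_apply, fderiv_clm_apply hd (differentiableAt_const e)]
    simp
  have hsm : ContDiff ℝ 2 (heatExtension g t) := contDiff_heatExtension_of_bound hg.continuous h0 ht
  -- left-hand side
  have hL : (Δ (heatExtension g t)) x =
      ∑ i, heatExtension (fun z => fderiv ℝ (fun z' => fderiv ℝ g z' (b i)) z (b i)) t x := by
    rw [laplacian_eq_iteratedFDeriv_orthonormalBasis (heatExtension g t) b]
    refine Finset.sum_congr rfl fun i _ => ?_
    rw [hpure hsm]
    have hfun : (fun y => fderiv ℝ (heatExtension g t) y (b i)) =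
        heatExtension (fun z => fderiv ℝ g z (b i)) t :=
      funext fun y => fderiv_heatExtension_apply_of_bounded hg1 h0 (hgi0 i) ht y
    have hgi1' : ∀ z, ‖fderiv ℝ (fun z' => fderiv ℝ g z' (b i)) z (b i)‖ ≤ C₂ := fun z => by
      refine (ContinuousLinearMap.le_opNorm _ _).trans ?_
      rw [b.orthonormal.1 i, mul_one]
      exact hgi1 i z
    rw [hfun, fderiv_heatExtension_apply_of_bounded (hgi i) (hgi0 i) hgi1' ht x]
  -- right-hand side
  have hR : (Δ g) = fun z => ∑ i, fderiv ℝ (fun z' => fderiv ℝ g z' (b i)) z (b i) := by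
    rw [laplacian_eq_iteratedFDeriv_orthonormalBasis g b]
    funext z
    exact Finset.sum_congr rfl fun i _ => hpure hg z (b i)
  rw [hL, hR, heatExtension_finset_sum]
  intro i _
  refine integrable_heatKernel_smul_of_bound
    (((hgi i).continuous_fderiv one_ne_zero).clm_apply continuous_const) (C := C₂ * ‖b i‖)
    (fun z => ?_) ht x
  exact (ContinuousLinearMap.le_opNorm _ _).trans (mul_le_mul_of_nonneg_right (hgi1 i z) (norm_nonneg _))

/-- **The heat equation with the Laplacian on bounded `C²` data**: `∂ₜ e^{tΔ} g (x) = e^{tΔ}(Δg)(x)`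
for `0 < t`. Evans, *PDE*, §2.3.1, Thm. 1 (ii). [cite: Evans2010, §2.3.1 Theorem 1(ii)] -/
theorem hasDerivAt_heatExtension_time_of_bounded [CompleteSpace F] {g : E → F} (hg : ContDiff ℝ 2 g)
    {C₀ C₁ C₂ : ℝ} (h0 : ∀ z, ‖g z‖ ≤ C₀) (h1 : ∀ z, ‖fderiv ℝ g z‖ ≤ C₁)
    (h2 : ∀ z, ‖fderiv ℝ (fderiv ℝ g) z‖ ≤ C₂) {t : ℝ} (ht : 0 < t) (x : E) :
    HasDerivAt (fun s => heatExtension g s x) (heatExtension (Δ g) t x) t := by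
  have h := hasDerivAt_heatExtension_time ht (memLp_top_of_continuous_of_bound hg.continuous h0) le_top x
  rwa [laplacian_heatExtension_of_bounded hg h0 h1 h2 ht x] at h

/-- **Linearity on bounded continuous data**: `e^{tΔ}(g + h) = e^{tΔ} g + e^{tΔ} h`. [folklore] -/
theorem heatExtension_add_of_bound {g h : E → F} (hg : Continuous g) (hh : Continuous h) {Cg Ch : ℝ}
    (hCg : ∀ z, ‖g z‖ ≤ Cg) (hCh : ∀ z, ‖h z‖ ≤ Ch) {t : ℝ} (ht : 0 < t) (x : E) :
    heatExtension (fun z => g z + h z) t x = heatExtension g t x + heatExtension h t x := by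
  simp_rw [heatExtension_apply, smul_add]
  exact integral_add (integrable_heatKernel_smul_of_bound hg hCg ht x)
    (integrable_heatKernel_smul_of_bound hh hCh ht x)

/-- `e^{tΔ}(g - h) = e^{tΔ} g - e^{tΔ} h` on bounded continuous data. [folklore] -/
theorem heatExtension_sub_of_bound {g h : E → F} (hg : Continuous g) (hh : Continuous h) {Cg Ch : ℝ}
    (hCg : ∀ z, ‖g z‖ ≤ Cg) (hCh : ∀ z, ‖h z‖ ≤ Ch) {t : ℝ} (ht : 0 < t) (x : E) :
    heatExtension (fun z => g z - h z) t x = heatExtension g t x - heatExtension h t x := by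
  simp_rw [heatExtension_apply, smul_sub]
  exact integral_sub (integrable_heatKernel_smul_of_bound hg hCg ht x)
    (integrable_heatKernel_smul_of_bound hh hCh ht x)

/-- `e^{tΔ} c = c` for a constant (`∫ G_t = 1`). [folklore] -/
theorem heatExtension_const [CompleteSpace F] (c : F) {t : ℝ} (ht : 0 < t) (x : E) :
    heatExtension (fun _ : E => c) t x = c := by
  rw [heatExtension_apply, integral_smul_const, integral_heatKernel_eq_one_holds ht, one_smul]

/-- `e^{tΔ}(a • g) = a • e^{tΔ} g`. [folklore] -/
theorem heatExtension_const_smul (a : ℝ) (g : E → F) (t : ℝ) (x : E) :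
    heatExtension (fun z => a • g z) t x = a • heatExtension g t x := by
  simp_rw [heatExtension_apply, smul_comm (heatKernel t _) a, integral_smul]

/-- `e^{tΔ}(L ∘ g) = L (e^{tΔ} g)` for a continuous linear `L` and bounded continuous `g`.
[folklore] -/
theorem heatExtension_clm_comp_of_bound {G : Type*} [NormedAddCommGroup G] [NormedSpace ℝ G]
    [CompleteSpace F] [CompleteSpace G] (L : F →L[ℝ] G) {g : E → F} (hg : Continuous g) {C : ℝ}
    (hC : ∀ z, ‖g z‖ ≤ C) {t : ℝ} (ht : 0 < t) (x : E) :
    heatExtension (fun z => L (g z)) t x = L (heatExtension g t x) := by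
  rw [heatExtension_apply, heatExtension_apply,
    ← L.integral_comp_comm (integrable_heatKernel_smul_of_bound hg hC ht x)]
  exact integral_congr_ae (Eventually.of_forall fun y => (L.map_smul _ _).symm)

/-! ### Sup bound for the gradient -/

/-- **Sup-norm gradient estimate** `‖∇(e^{tΔ} f)(x)‖ ≤ 2^{n/2} t^{-1/2} C` whenever `‖f‖ ≤ C`
everywhere (`f` measurable): the case `p = ∞` of Giga–Giga–Saal, §1.1.3, in pointwise form
(`‖∇(e^{tΔ}f)(x)‖ ≤ ∫ ‖∇G_t(y)‖ ‖f(x-y)‖ dy ≤ C ‖∇G_t‖₁`). [cite: GigaGigaSaal2010, §1.1.3] -/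
theorem norm_fderiv_heatExtension_le_of_bounded [CompleteSpace F] {f : E → F}
    (hf : AEStronglyMeasurable f volume) {C : ℝ} (hC : ∀ z, ‖f z‖ ≤ C) {t : ℝ} (ht : 0 < t) (x : E) :
    ‖fderiv ℝ (heatExtension f t) x‖ ≤
      (2 : ℝ) ^ ((Module.finrank ℝ E : ℝ) / 2) * t ^ (-(1 / 2 : ℝ)) * C := by
  have hmem : MemLp f ∞ (volume : Measure E) := memLp_top_of_bound hf C (Eventually.of_forall hC)
  have h1 := norm_fderiv_heatExtension_le hmem le_top ht x
  rw [convolution_def] at h1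
  simp only [ContinuousLinearMap.lsmul_apply, smul_eq_mul] at h1
  have hint : Integrable (fun y => ‖fderiv ℝ (heatKernel t) y‖ * C) (volume : Measure E) :=
    (integrable_norm_fderiv_heatKernel ht).mul_const C
  have hC0 : 0 ≤ C := (norm_nonneg _).trans (hC x)
  refine h1.trans ?_
  calc ∫ y, ‖fderiv ℝ (heatKernel t) y‖ * ‖f (x - y)‖
      ≤ ∫ y, ‖fderiv ℝ (heatKernel t) y‖ * C := by
        refine integral_mono_of_nonneg (Eventually.of_forall fun y => by positivity) hint
          (Eventually.of_forall fun y => ?_)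
        exact mul_le_mul_of_nonneg_left (hC _) (norm_nonneg _)
    _ = (∫ y, ‖fderiv ℝ (heatKernel t) y‖) * C := integral_mul_const _ _
    _ ≤ _ := mul_le_mul_of_nonneg_right (integral_norm_fderiv_heatKernel_le ht) hC0

/-- Directional form: `‖∂ᵥ(e^{tΔ} f)(x)‖ ≤ 2^{n/2} t^{-1/2} C ‖v‖`. [cite: GigaGigaSaal2010, §1.1.3] -/
theorem norm_fderiv_heatExtension_apply_le_of_bounded [CompleteSpace F] {f : E → F}
    (hf : AEStronglyMeasurable f volume) {C : ℝ} (hC : ∀ z, ‖f z‖ ≤ C) {t : ℝ} (ht : 0 < t)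
    (x v : E) :
    ‖fderiv ℝ (heatExtension f t) x v‖ ≤
      (2 : ℝ) ^ ((Module.finrank ℝ E : ℝ) / 2) * t ^ (-(1 / 2 : ℝ)) * C * ‖v‖ :=
  (ContinuousLinearMap.le_opNorm _ _).trans
    (mul_le_mul_of_nonneg_right (norm_fderiv_heatExtension_le_of_bounded hf hC ht x) (norm_nonneg _))

/-! ### Hölder gains -/

/-- The caloric extension minus the datum as a single integral:
`e^{tΔ} g (x) - g x = ∫ G_t(y) • (g(x - y) - g x) dy` (`∫ G_t = 1`). [folklore] -/
theorem heatExtension_sub_self_eq_integral [CompleteSpace F] {g : E → F} (hg : Continuous g) {C : ℝ}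
    (hC : ∀ z, ‖g z‖ ≤ C) {t : ℝ} (ht : 0 < t) (x : E) :
    heatExtension g t x - g x = ∫ y, heatKernel t y • (g (x - y) - g x) := by
  simp_rw [smul_sub]
  rw [integral_sub (integrable_heatKernel_smul_of_bound hg hC ht x)
    ((integrable_heatKernel_holds ht).smul_const _), integral_smul_const,
    integral_heatKernel_eq_one_holds ht, one_smul, heatExtension_apply]

/-- **Mollification error for Hölder data**: if `‖g y - g z‖ ≤ A ‖y - z‖^β` with `0 ≤ β ≤ 1`
(and `g` bounded continuous), then `‖e^{tΔ} g (x) - g x‖ ≤ (1 + 2·2^{n/2}) A t^{β/2}` — the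
estimate `‖f ⋆ ψ_ℓ - f‖₀ ≲ [f]_β ℓ^β` of BDSV 2019, §2.2, for the Gaussian at `ℓ = √t`.
[cite: BuckmasterEtAl2018, §2.2 (standard mollification estimates)] -/
theorem norm_heatExtension_sub_self_le_of_holder [CompleteSpace F] {g : E → F} (hg : Continuous g)
    {C : ℝ} (hC : ∀ z, ‖g z‖ ≤ C) {A β : ℝ} (hA : 0 ≤ A) (hβ0 : 0 ≤ β) (hβ1 : β ≤ 1)
    (hH : ∀ y z, ‖g y - g z‖ ≤ A * ‖y - z‖ ^ β) {t : ℝ} (ht : 0 < t) (x : E) :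
    ‖heatExtension g t x - g x‖ ≤
      (1 + 2 * (2 : ℝ) ^ ((Module.finrank ℝ E : ℝ) / 2)) * A * t ^ (β / 2) := by
  rw [heatExtension_sub_self_eq_integral hg hC ht x]
  have hmeas : AEStronglyMeasurable (fun y : E => heatKernel t y * ‖y‖ ^ β) volume :=
    ((continuous_heatKernel t).mul (continuous_norm.rpow_const fun _ => Or.inr hβ0)).aestronglyMeasurable
  -- integrability of the majorant `A G_t(y) ‖y‖^β` via the splitting inequality
  have hr0 : 0 < (1 : ℝ) := one_pos
  have hdom : Integrable (fun y : E => A * (heatKernel t y * ‖y‖ ^ β)) := by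
    refine Integrable.const_mul ?_ A
    refine (((integrable_heatKernel_holds ht).mul_const ((1 : ℝ) ^ β)).add
      ((integrable_heatKernel_mul_norm ht).const_mul ((1 : ℝ) ^ (β - 1)))).mono' hmeas
      (Eventually.of_forall fun y => ?_)
    rw [Real.norm_of_nonneg (mul_nonneg (heatKernel_pos ht y).le (Real.rpow_nonneg (norm_nonneg _) _))]
    have h := rpow_le_rpow_add_rpow_sub_one_mul (norm_nonneg y) hr0 hβ0 hβ1
    calc heatKernel t y * ‖y‖ ^ β ≤ heatKernel t y * ((1 : ℝ) ^ β + (1 : ℝ) ^ (β - 1) * ‖y‖) :=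
          mul_le_mul_of_nonneg_left h (heatKernel_pos ht y).le
      _ = heatKernel t y * (1 : ℝ) ^ β + (1 : ℝ) ^ (β - 1) * (heatKernel t y * ‖y‖) := by ring
  calc ‖∫ y, heatKernel t y • (g (x - y) - g x)‖
      ≤ ∫ y, A * (heatKernel t y * ‖y‖ ^ β) := by
        refine norm_integral_le_of_norm_le hdom (Eventually.of_forall fun y => ?_)
        rw [norm_smul, Real.norm_of_nonneg (heatKernel_pos ht y).le]
        have h := hH (x - y) x
        rw [show x - y - x = -y by abel, norm_neg] at h
        calc heatKernel t y * ‖g (x - y) - g x‖ ≤ heatKernel t y * (A * ‖y‖ ^ β) :=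
              mul_le_mul_of_nonneg_left h (heatKernel_pos ht y).le
          _ = A * (heatKernel t y * ‖y‖ ^ β) := by ring
    _ = A * ∫ y, heatKernel t y * ‖y‖ ^ β := integral_const_mul _ _
    _ ≤ A * ((1 + 2 * (2 : ℝ) ^ ((Module.finrank ℝ E : ℝ) / 2)) * t ^ (β / 2)) :=
        mul_le_mul_of_nonneg_left (integral_heatKernel_mul_norm_rpow_le ht hβ0 hβ1) hA
    _ = _ := by ring

/-- The gradient of the caloric extension of bounded measurable data as an integral against
increments: `∇(e^{tΔ} g)(x) = ∫ ∇G_t(y) ⊗ (g(x - y) - g x) dy` (`∫ ∇G_t = 0`). [folklore] -/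
theorem fderiv_heatExtension_eq_integral_sub_self [CompleteSpace F] {g : E → F} (hg : Continuous g)
    {C : ℝ} (hC : ∀ z, ‖g z‖ ≤ C) {t : ℝ} (ht : 0 < t) (x : E) :
    fderiv ℝ (heatExtension g t) x =
      ∫ y, (fderiv ℝ (heatKernel t) y).smulRight (g (x - y) - g x) := by
  have hmem : MemLp g ∞ (volume : Measure E) := memLp_top_of_continuous_of_bound hg hC
  rw [fderiv_heatExtension_eq hmem le_top ht]
  dsimp only
  -- change variables `y ↦ x - y`
  have hcv := integral_sub_left_eq_self
    (fun y => (fderiv ℝ (heatKernel t) y).smulRight (g (x - y))) volume x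
  simp only [sub_sub_cancel] at hcv
  rw [hcv]
  -- subtract the vanishing term `(∫ ∇G_t) ⊗ g x`
  have hint1 : Integrable (fun y => (fderiv ℝ (heatKernel t) y).smulRight (g (x - y)))
      (volume : Measure E) := by
    refine ((integrable_norm_fderiv_heatKernel ht).mul_const C).mono'
      ((ContinuousLinearMap.smulRightL ℝ E F).continuous₂.comp_aestronglyMeasurable
        ((continuous_fderiv_heatKernel t).aestronglyMeasurable.prodMk
          (hg.comp (continuous_const.sub continuous_id)).aestronglyMeasurable))
      (Eventually.of_forall fun y => ?_)
    rw [ContinuousLinearMap.norm_smulRight_apply]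
    exact mul_le_mul_of_nonneg_left (hC _) (norm_nonneg _)
  have hIop : Integrable (fderiv ℝ (heatKernel t)) (volume : Measure E) :=
    (integrable_norm_iff (continuous_fderiv_heatKernel t).aestronglyMeasurable).1
      (integrable_norm_fderiv_heatKernel ht)
  have hint2 : Integrable (fun y => (fderiv ℝ (heatKernel t) y).smulRight (g x))
      (volume : Measure E) :=
    ((ContinuousLinearMap.smulRightL ℝ E F).flip (g x)).integrable_comp hIop
  have hzero : ∫ y, (fderiv ℝ (heatKernel t) y).smulRight (g x) = (0 : E →L[ℝ] F) := by
    have h := ((ContinuousLinearMap.smulRightL ℝ E F).flip (g x)).integral_comp_comm hIop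
    simp only [ContinuousLinearMap.flip_apply, ContinuousLinearMap.smulRightL_apply_apply] at h
    -- `h : ∫ smulRightL (∇G y) (g x) = smulRightL (∫ ∇G) (g x)`
    have h' : (fun y => (fderiv ℝ (heatKernel t) y).smulRight (g x)) =
        fun y => (ContinuousLinearMap.smulRightL ℝ E F) (fderiv ℝ (heatKernel t) y) (g x) := by
      funext y; ext v; simp
    rw [h'] at h ⊢
    rw [h, integral_fderiv_heatKernel_eq_zero]
    ext v; simp
  have hsub : (fun y => (fderiv ℝ (heatKernel t) y).smulRight (g (x - y) - g x)) = fun y =>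
      (fderiv ℝ (heatKernel t) y).smulRight (g (x - y)) - (fderiv ℝ (heatKernel t) y).smulRight (g x) := by
    funext y; ext v; simp [smul_sub]
  rw [hsub, integral_sub hint1 hint2, hzero, sub_zero]

/-- **Gradient of the mollification of Hölder data**: if `‖g y - g z‖ ≤ A ‖y - z‖^β` with
`0 ≤ β ≤ 1` (and `g` bounded continuous), then
`‖∇(e^{tΔ} g)(x)‖ ≤ 2^{n/2} t^{-1/2} (1 + 2·2^{n/2}) (2t)^{β/2} A` — the estimate
`‖∇(f ⋆ ψ_ℓ)‖₀ ≲ [f]_β ℓ^{β-1}` of BDSV 2019, §2.2, for the Gaussian at `ℓ = √t`.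
[cite: BuckmasterEtAl2018, §2.2 (standard mollification estimates)] -/
theorem norm_fderiv_heatExtension_le_of_holder [CompleteSpace F] {g : E → F} (hg : Continuous g)
    {C : ℝ} (hC : ∀ z, ‖g z‖ ≤ C) {A β : ℝ} (hA : 0 ≤ A) (hβ0 : 0 ≤ β) (hβ1 : β ≤ 1)
    (hH : ∀ y z, ‖g y - g z‖ ≤ A * ‖y - z‖ ^ β) {t : ℝ} (ht : 0 < t) (x : E) :
    ‖fderiv ℝ (heatExtension g t) x‖ ≤
      (2 : ℝ) ^ ((Module.finrank ℝ E : ℝ) / 2) * t ^ (-(1 / 2 : ℝ)) *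
        ((1 + 2 * (2 : ℝ) ^ ((Module.finrank ℝ E : ℝ) / 2)) * (2 * t) ^ (β / 2)) * A := by
  rw [fderiv_heatExtension_eq_integral_sub_self hg hC ht x]
  set c : ℝ := (2 : ℝ) ^ ((Module.finrank ℝ E : ℝ) / 2) * t ^ (-(1 / 2 : ℝ)) with hc
  have h2t : 0 < 2 * t := by positivity
  -- integrability of the majorant `A ‖∇G_t(y)‖ ‖y‖^β`
  have hmeas : AEStronglyMeasurable (fun y : E => ‖fderiv ℝ (heatKernel t) y‖ * ‖y‖ ^ β) volume :=
    ((continuous_fderiv_heatKernel t).norm.mul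
      (continuous_norm.rpow_const fun _ => Or.inr hβ0)).aestronglyMeasurable
  have hdom : Integrable (fun y : E => A * (‖fderiv ℝ (heatKernel t) y‖ * ‖y‖ ^ β)) := by
    refine Integrable.const_mul ?_ A
    have hI := integrable_norm_fderiv_heatKernel (E := E) ht
    have hJ := (integrable_heatKernel_mul_norm (E := E) h2t).const_mul c
    refine (hI.add hJ).mono' hmeas (Eventually.of_forall fun y => ?_)
    rw [Real.norm_of_nonneg (mul_nonneg (norm_nonneg _) (Real.rpow_nonneg (norm_nonneg _) _))]
    have hsplit := rpow_le_rpow_add_rpow_sub_one_mul (norm_nonneg y) one_pos hβ0 hβ1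
    simp only [Real.one_rpow, one_mul] at hsplit
    have hgrad := norm_fderiv_heatKernel_le_heatKernel_two_mul ht y
    calc ‖fderiv ℝ (heatKernel t) y‖ * ‖y‖ ^ β ≤ ‖fderiv ℝ (heatKernel t) y‖ * (1 + ‖y‖) :=
          mul_le_mul_of_nonneg_left hsplit (norm_nonneg _)
      _ = ‖fderiv ℝ (heatKernel t) y‖ + ‖fderiv ℝ (heatKernel t) y‖ * ‖y‖ := by ring
      _ ≤ ‖fderiv ℝ (heatKernel t) y‖ + c * heatKernel (2 * t) y * ‖y‖ :=
          add_le_add le_rfl (mul_le_mul_of_nonneg_right hgrad (norm_nonneg _))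
      _ = ‖fderiv ℝ (heatKernel t) y‖ + c * (heatKernel (2 * t) y * ‖y‖) := by ring
  calc ‖∫ y, (fderiv ℝ (heatKernel t) y).smulRight (g (x - y) - g x)‖
      ≤ ∫ y, A * (‖fderiv ℝ (heatKernel t) y‖ * ‖y‖ ^ β) := by
        refine norm_integral_le_of_norm_le hdom (Eventually.of_forall fun y => ?_)
        rw [ContinuousLinearMap.norm_smulRight_apply]
        have h := hH (x - y) x
        rw [show x - y - x = -y by abel, norm_neg] at h
        calc ‖fderiv ℝ (heatKernel t) y‖ * ‖g (x - y) - g x‖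
            ≤ ‖fderiv ℝ (heatKernel t) y‖ * (A * ‖y‖ ^ β) := mul_le_mul_of_nonneg_left h (norm_nonneg _)
          _ = A * (‖fderiv ℝ (heatKernel t) y‖ * ‖y‖ ^ β) := by ring
    _ = A * ∫ y, ‖fderiv ℝ (heatKernel t) y‖ * ‖y‖ ^ β := integral_const_mul _ _
    _ ≤ A * (c * ((1 + 2 * (2 : ℝ) ^ ((Module.finrank ℝ E : ℝ) / 2)) * (2 * t) ^ (β / 2))) :=
        mul_le_mul_of_nonneg_left (integral_norm_fderiv_heatKernel_mul_norm_rpow_le ht hβ0 hβ1) hA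
    _ = _ := by rw [hc]; ring

/-- Directional form of the Hölder gradient gain:
`‖∂ᵥ(e^{tΔ} g)(x)‖ ≤ 2^{n/2} t^{-1/2} (1 + 2·2^{n/2}) (2t)^{β/2} A ‖v‖`.
[cite: BuckmasterEtAl2018, §2.2 (standard mollification estimates)] -/
theorem norm_fderiv_heatExtension_apply_le_of_holder [CompleteSpace F] {g : E → F}
    (hg : Continuous g) {C : ℝ} (hC : ∀ z, ‖g z‖ ≤ C) {A β : ℝ} (hA : 0 ≤ A) (hβ0 : 0 ≤ β)
    (hβ1 : β ≤ 1) (hH : ∀ y z, ‖g y - g z‖ ≤ A * ‖y - z‖ ^ β) {t : ℝ} (ht : 0 < t) (x v : E) :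
    ‖fderiv ℝ (heatExtension g t) x v‖ ≤
      (2 : ℝ) ^ ((Module.finrank ℝ E : ℝ) / 2) * t ^ (-(1 / 2 : ℝ)) *
        ((1 + 2 * (2 : ℝ) ^ ((Module.finrank ℝ E : ℝ) / 2)) * (2 * t) ^ (β / 2)) * A * ‖v‖ :=
  (ContinuousLinearMap.le_opNorm _ _).trans (mul_le_mul_of_nonneg_right
    (norm_fderiv_heatExtension_le_of_holder hg hC hA hβ0 hβ1 hH ht x) (norm_nonneg _))

end BoundedData

end Literature.Analysis.UnboundedOperators
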